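import Literature.Computability.Complexity.TM2Iterate
import Literature.Computability.Complexity.Transducers
import Mathlib.Data.List.ReduceOption
import HarnessLib

/-!
# Clocked iteration with an interleaved clock; transducer passes as loop bodies

Trunk `CplxCore`, toolkit over Mathlib's multi-stack machines (`Turing.FinTM2`), continuing
`TM2Iterate.lean` (the loop machine `TM2Iter.iterTM`, which on input
`replicate n none ++ x.map some` runs a machine `n` times, re-feeding outputs as inputs) and
`Transducers.lean` (finite-state transducers `FST` are linear-time, `FST.timeComputable_eval`).
Two additions, needed to build *exponential-time* machines compositionally (the brute-force
`k`-SAT decider behind `Literature.Computability.FineGrained.kSATInExpTime_one`):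

* **Interleaved clocks.** The first phase `init1` of the loop machine sorts its input symbol by
  symbol (`none` = one clock tick onto the counter stack, `some γ` = one data symbol onto the
  transfer stack), so the clock need not precede the data: on *any* word `w : List (Option A)`
  the loop machine computes `F^[w.countP Option.isNone] (w.reduceOption)` — the *ticks* of `w`
  are its `none`s (`List.countP Option.isNone`), its *data* is `List.reduceOption`
  (`TM2Iter.init1_mixed`, `TM2Iter.iterAux_outputsWithin_mixed`). Consequently the clock of a
  loop stage can be *emitted by a finite-state transducer* of the previous stage (a transducer
  cannot move all ticks in front of the data, but it can interleave them), which is how a stage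
  running `2^v` rounds is clocked by a previous stage that doubled a block of ticks `v` times.
* **Explicit time.** The bound is stated with an explicit uniform size bound `B` on the
  iterates (not only the linear-growth form of `TM2Iter.iterAux_outputsWithin`):
  `|w| + B + ticks · (2B + 3 + p B) + 4` steps; for a transducer pass `T` as loop body
  (`FST.exists_iterate_outputsWithin`) this reads `|w| + B + ticks · ((maxEmit T + 3) B + 6) + 4`.

All of this is routine bookkeeping over the phase lemmas of `TM2Iterate.lean`
(`step_init1_some/none/nil`, `init2_run`, `loop_run`); nothing here is in Mathlib, whose only
timed `TM2` machine is the identity. The four `reduceOption`/`countP` lemmas below are one-line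
specialisations of Mathlib/core lemmas, kept as `simp` lemmas for the pipeline files.

## References

* S. Arora, B. Barak, *Computational Complexity: A Modern Approach*, CUP 2009, §1.4.1
  (universal TM with time bound: the step counter), §1.3 (machine constructions).
* J. E. Hopcroft, J. D. Ullman, *Introduction to Automata Theory, Languages, and Computation*,
  Addison-Wesley 1979, §2.7 (Mealy machines), §11.2 (generalised sequential machines).
-/

namespace Literature.Computability.Complexity

namespace TM2Iter

open Turing StateTransition Function

variable {A : Type}

/-! ### Ticks (`countP isNone`) and data (`reduceOption`) of blocks of a mixed word -/

/-- A block of data symbols carries exactly its data (`List.filterMap_some`). [folklore] -/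
@[simp] theorem reduceOption_map_some (x : List A) : (x.map some).reduceOption = x := by
  simp [List.reduceOption, List.filterMap_map]

/-- A block of data symbols has no tick (`List.countP_map`). [folklore] -/
@[simp] theorem countP_isNone_map_some (x : List A) : (x.map some).countP Option.isNone = 0 := by
  simp

/-- The data of a `flatMap` is the `flatMap` of the data (`List.filterMap_flatMap`). [folklore] -/
theorem reduceOption_flatMap {β : Type} (f : β → List (Option A)) (l : List β) :
    (l.flatMap f).reduceOption = l.flatMap fun b => (f b).reduceOption :=
  List.filterMap_flatMap

/-- The ticks of a `flatMap` are the sum of the ticks (`List.countP_flatMap`). [folklore] -/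
theorem countP_isNone_flatMap {β : Type} (f : β → List (Option A)) (l : List β) :
    (l.flatMap f).countP Option.isNone = (l.map fun b => (f b).countP Option.isNone).sum := by
  rw [List.countP_flatMap]; rfl

/-! ### The first phase of the loop machine on a mixed word -/

section Mixed

variable (M : FinTM2) [Inhabited A] (eIn : M.Γ M.k₀ ≃ A) (eOut : M.Γ M.k₁ ≃ A)
  (v : M.σ) (S : ∀ k, List (M.Γ k))

/-- `init1` on a mixed word: ticks (`none`) go to the counter stack, data symbols (reversed) to
the transfer stack, one step per symbol. [folklore] -/
theorem init1_mixed (w rest : List (Option A)) (t : List A) (c : List Unit) :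
    ReachesIn (C := LCfg M A) (iterTM M eIn eOut).step
      (cfg M A (some (Sum.inr Ctrl.init1)) v S (w ++ rest) t c)
      (cfg M A (some (Sum.inr Ctrl.init1)) v S rest (w.reduceOption.reverse ++ t)
        (List.replicate (w.countP Option.isNone) () ++ c)) w.length := by
  induction w generalizing t c with
  | nil => simpa using ReachesIn.refl _ _
  | cons o w ih =>
    cases o with
    | none =>
      have h : List.replicate (w.countP Option.isNone + 1) () ++ c =
          List.replicate (w.countP Option.isNone) () ++ (() :: c) := by
        rw [List.replicate_succ', List.append_assoc, List.singleton_append]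
      rw [List.cons_append, List.countP_cons_of_pos (Option.isNone_none), List.reduceOption_cons_of_none, h]
      exact ReachesIn.step_trans (step_init1_none M eIn eOut v S _ t c) (ih t (() :: c))
    | some s =>
      rw [List.cons_append, List.countP_cons_of_neg (by simp), List.reduceOption_cons_of_some]
      simpa [List.append_assoc] using
        ReachesIn.step_trans (step_init1_some M eIn eOut v S (w ++ rest) t c s) (ih (s :: t) c)

end Mixed

/-! ### The loop machine on a mixed word, with an explicit size bound -/

section Main

variable {α : Type} [Inhabited A] {ea : α → List A} {F : α → α}
  (Mx : TM2ComputableAux A A) (p : Polynomial ℕ)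
  (hF : ∀ a, Mx.OutputsWithin (ea a) (ea (F a)) (p.eval (ea a).length))

include hF in
/-- **The loop machine on a mixed input word.** If `w.reduceOption = ea a` and all iterates
`ea (F^[i] a)`, `i ≤ N := w.countP isNone`, have length `≤ B`, then on input `w` the loop machine
of `Mx` halts with output `ea (F^[N] a)` within `|w| + B + N · (2B + 3 + p B) + 4` steps
(the step counter of a clocked universal machine, Arora–Barak 2009, §1.4.1). [folklore] -/
theorem iterAux_outputsWithin_mixed (w : List (Option A)) (a : α) (ha : w.reduceOption = ea a) (B : ℕ)
    (hB : ∀ i ≤ w.countP Option.isNone, (ea (F^[i] a)).length ≤ B) :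
    (iterAux Mx).OutputsWithin w (ea (F^[w.countP Option.isNone] a))
      (w.length + B + w.countP Option.isNone * (2 * B + 3 + p.eval B) + 4) := by
  apply outputsWithin_of_reachesIn
  have hin : w.map (iterAux Mx).inputAlphabet.symm = w := List.map_id _
  rw [hin]
  change ReachesIn (C := LCfg Mx.tm A) (iterTM Mx.tm Mx.inputAlphabet Mx.outputAlphabet).step
    (initList (iterTM Mx.tm Mx.inputAlphabet Mx.outputAlphabet) _)
    (haltList (iterTM Mx.tm Mx.inputAlphabet Mx.outputAlphabet)
      ((ea (F^[w.countP Option.isNone] a)).map Mx.outputAlphabet.symm)) _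
  rw [initList_iterTM, haltList_iterTM]
  -- init1 (mixed), init2, then the main loop
  have h1 := init1_mixed Mx.tm Mx.inputAlphabet Mx.outputAlphabet Mx.tm.initialState (fun _ => [])
    w [] [] []
  have h2 := ReachesIn.single (step_init1_nil Mx.tm Mx.inputAlphabet Mx.outputAlphabet
    Mx.tm.initialState (fun _ => []) (w.reduceOption.reverse ++ [])
    (List.replicate (w.countP Option.isNone) () ++ []))
  have h3 := init2_run Mx.tm Mx.inputAlphabet Mx.outputAlphabet Mx.tm.initialState (fun _ => [])
    [] (w.reduceOption.reverse ++ []) (List.replicate (w.countP Option.isNone) () ++ [])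
  simp only [List.append_nil, List.reverse_reverse, List.length_reverse] at h1 h2 h3
  have h4 := loop_run Mx p hF a B (w.countP Option.isNone) 0 (fun i hi => hB i (by omega))
  rw [iterate_zero_apply, Nat.zero_add] at h4
  rw [ha] at h1 h2 h3
  have := (((h1.trans h2).trans h3).trans h4)
  refine this.mono ?_
  have h0 : (ea a).length ≤ B := by simpa using hB 0 (Nat.zero_le _)
  omega

end Main

end TM2Iter

/-! ### Transducer passes as loop bodies -/

namespace FST

open TM2Iter Function

variable {σ A : Type} [Fintype σ] [Fintype A] (T : FST σ A A)

/-- **Iterating a transducer pass with an interleaved clock.** There is a machine which, on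
any mixed word `w` (ticks `none`, data `some γ`; `N := w.countP isNone`), outputs
`T.eval^[N] w.reduceOption` within `|w| + B + N · ((maxEmit + 3) B + 6) + 4` steps, for every
uniform bound `B` on the lengths of the passes `T.eval^[i] w.reduceOption`, `i ≤ N` (the loop
machine of `TM2Iterate.lean` around the transducer machine of `FST.timeComputable_eval`).
[folklore] -/
theorem exists_iterate_outputsWithin [Inhabited A] :
    ∃ M : Turing.TM2ComputableAux (Option A) A, ∀ (w : List (Option A)) (B : ℕ),
      (∀ i ≤ w.countP Option.isNone, (T.eval^[i] w.reduceOption).length ≤ B) →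
        M.OutputsWithin w (T.eval^[w.countP Option.isNone] w.reduceOption)
          (w.length + B + w.countP Option.isNone * ((T.maxEmit + 3) * B + 6) + 4) := by
  obtain ⟨Mx, hMx⟩ := T.timeComputable_eval
  refine ⟨iterAux Mx, fun w B hB => ?_⟩
  have hF : ∀ l : List A, Mx.OutputsWithin (id l) (id (T.eval l))
      ((Polynomial.C (T.maxEmit + 1) * Polynomial.X + 3 : Polynomial ℕ).eval (id l).length) := by
    intro l; simpa using hMx l
  have := iterAux_outputsWithin_mixed (ea := id) (F := T.eval) Mx _ hF w w.reduceOption rfl B hB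
  refine this.mono (le_of_eq ?_)
  simp only [Polynomial.eval_add, Polynomial.eval_mul, Polynomial.eval_C, Polynomial.eval_X,
    Polynomial.eval_ofNat]
  ring

end FST

end Literature.Computability.Complexity
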